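import Summits.Ventures.PercRepro.C041LeafMoments
import Summits.Ventures.PercRepro.C041StarBoundsTwo

/-!
# THE LAST SEED IS MONOTONE IN `(P₁, P₂)` — the lower-frontier reduction (mine-3, gen 64; C-041.md §21 (ay))

`θ_△(v 1, w)` is AFFINE in the coordinates `L₁ = P₁`, `L₂ = P₂` of `w`, and both gradients are cone elements:
`∂/∂P₁ = (5, 16, 5, 0, 5, 0) = 2·v 1 + 3·v 1²` and `∂/∂P₂ = (4, 5, 10, 0, 0, 2) = 4·v 0·v ½` (`thetaTri_v1_shift`).  Hence
`Ω_{A,B} = {(P₁, P₂) : θ_△(v 1, (1, P₁, P₂, AB, A, B)) ∈ cone}` is convex and upward closed (`InCone_thetaTri_v1_of_le`), and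
the seed for EVERY star follows from the seed at ANY point `(p₁, p₂) ≤ (P₁, P₂)` — in particular on the lower frontier of a
region `H ⊇ {stars}` cut out by the star bounds of `C041StarBounds` / `C041StarBoundsTwo` (`InCone_thetaTri_v1_V_of_lower`):
a bounded three-parameter family `(A, B, P₁)` replaces the four-parameter star region with its unbounded directions.
-/

namespace PercRepro

namespace RelaxedTriangle

open TreeClosure

/-- The `P₁`-gradient of the seed is a cone element: `(5, 16, 5, 0, 5, 0) = 2·v 1 + 3·(v 1 * v 1)`. -/
theorem seed_grad_one : (![5, 16, 5, 0, 5, 0] : Vec6) = (2 : ℝ) • v 1 + (3 : ℝ) • (v 1 * v 1) := by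
  ext i
  simp only [Pi.add_apply, Pi.smul_apply, Pi.mul_apply, smul_eq_mul, v]
  fin_cases i <;> simp <;> norm_num

/-- The `P₂`-gradient of the seed is a cone element: `(4, 5, 10, 0, 0, 2) = 4·(v 0 * v ½)`. -/
theorem seed_grad_two : (![4, 5, 10, 0, 0, 2] : Vec6) = (4 : ℝ) • (v 0 * v (1 / 2)) := by
  ext i
  simp only [Pi.smul_apply, Pi.mul_apply, smul_eq_mul, v]
  fin_cases i <;> simp <;> norm_num

/-- **THE SHIFT IDENTITY**: lowering the coordinates `L₁, L₂` of `w` to `p₁, p₂` changes `θ_△(v 1, w)` by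
`(L₁ − p₁)·(2 v 1 + 3 v 1²) + (L₂ − p₂)·4 v 0 v ½`. -/
theorem thetaTri_v1_shift (w : Vec6) (p1 p2 : ℝ) :
    thetaTri (v 1) w = thetaTri (v 1) ![w 0, p1, p2, w 3, w 4, w 5]
      + (w 1 - p1) • ((2 : ℝ) • v 1 + (3 : ℝ) • (v 1 * v 1)) + (w 2 - p2) • ((4 : ℝ) • (v 0 * v (1 / 2))) := by
  rw [thetaTri_v1_coords, thetaTri_v1_coords]
  ext i
  simp only [Pi.add_apply, Pi.smul_apply, Pi.mul_apply, smul_eq_mul, v]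
  fin_cases i <;> simp <;> ring

/-- The `P₁`-gradient is in the cone. -/
theorem InCone_seed_grad_one : InCone ((2 : ℝ) • v 1 + (3 : ℝ) • (v 1 * v 1)) :=
  InCone.add (InCone.smul _ (by norm_num) (InCone_v 1 ⟨zero_le_one, le_rfl⟩))
    (InCone.smul _ (by norm_num) (InCone.mul (InCone_v 1 ⟨zero_le_one, le_rfl⟩) (InCone_v 1 ⟨zero_le_one, le_rfl⟩)))

/-- The `P₂`-gradient is in the cone. -/
theorem InCone_seed_grad_two : InCone ((4 : ℝ) • (v 0 * v (1 / 2))) :=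
  InCone.smul _ (by norm_num) (InCone.mul (InCone_v 0 ⟨le_rfl, zero_le_one⟩) (InCone_v (1 / 2) ⟨by norm_num, by norm_num⟩))

/-- **MONOTONICITY**: if the seed holds at `(w 0, p₁, p₂, w 3, w 4, w 5)` with `p₁ ≤ L₁(w)`, `p₂ ≤ L₂(w)`, it holds at `w`. -/
theorem InCone_thetaTri_v1_of_le {w : Vec6} {p1 p2 : ℝ} (h1 : p1 ≤ w 1) (h2 : p2 ≤ w 2)
    (h : InCone (thetaTri (v 1) ![w 0, p1, p2, w 3, w 4, w 5])) : InCone (thetaTri (v 1) w) := by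
  rw [thetaTri_v1_shift w p1 p2]
  exact InCone.add (InCone.add h (InCone.smul _ (by linarith) InCone_seed_grad_one))
    (InCone.smul _ (by linarith) InCone_seed_grad_two)

/-- **THE LOWER-FRONTIER REDUCTION** for stars with at least two leaves: if the seed holds at every point
`(1, p₁, p₂, AB, A, B)` that satisfies the star bounds `1 + A² ≤ p₁ ≤ P₁`, `1 + B² ≤ p₂ ≤ P₂`, `4A ≤ p₁`, `4B ≤ p₂`,
`(3/2)(1 − A)² ≤ p₁(p₂ − 1)`, `(3/2)(1 − B)² ≤ p₂(p₁ − 1)`, `((1 − A)(1 − B))² ≤ (p₁ − 1)(p₂ − 1)`, `p₁² B ≤ 1`,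
`p₂² A ≤ 1` for SOME `(p₁, p₂) ≤ (P₁, P₂)` chosen by the frontier rule `f`, then it holds at every star.  (`f` picks the
lowered point; the hypothesis `hf` says the chosen point keeps the bounds — e.g. `f P₁ P₂ A B = (P₁, min P₂ c)` on a
piece with cap `c` above its frontier.) -/
theorem InCone_thetaTri_v1_V_of_lower {m : ℕ} (a : Fin (m + 2) → ℝ) (ha : ∀ i, 0 ≤ a i ∧ a i ≤ 1)
    (f : ℝ → ℝ → ℝ → ℝ → ℝ × ℝ)
    (hf : ∀ P1 P2 A B, 0 ≤ A → A ≤ 1 → 0 ≤ B → B ≤ 1 → 1 + A ^ 2 ≤ P1 → 1 + B ^ 2 ≤ P2 → 4 * A ≤ P1 → 4 * B ≤ P2 →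
      3 / 2 * (1 - A) ^ 2 ≤ P1 * (P2 - 1) → 3 / 2 * (1 - B) ^ 2 ≤ P2 * (P1 - 1) →
      ((1 - A) * (1 - B)) ^ 2 ≤ (P1 - 1) * (P2 - 1) → P1 ^ 2 * B ≤ 1 → P2 ^ 2 * A ≤ 1 →
      (f P1 P2 A B).1 ≤ P1 ∧ (f P1 P2 A B).2 ≤ P2 ∧
        InCone (thetaTri (v 1) ![1, (f P1 P2 A B).1, (f P1 P2 A B).2, A * B, A, B])) :
    InCone (thetaTri (v 1) (V a)) := by
  have hc := TreeClosure.V_coords a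
  obtain ⟨hA0, hA1⟩ := prod_unit_mem a ha
  obtain ⟨hB0, hB1⟩ := prod_unit_mem (fun i => 1 - a i) (fun i => ⟨by linarith [(ha i).2], by linarith [(ha i).1]⟩)
  have h1 := one_add_prod_sq_le a ha
  have h2 := one_add_prod_one_sub_sq_le a ha
  have h4a := four_mul_prod_le_prod_one_add_sq a ha
  have h4b := four_mul_prod_one_sub_le_prod a ha
  have hR := sharp_R a ha
  have hRm := sharp_R_mirror a ha
  have hU := U_ineq a ha
  have hu1 := prod_one_add_sq_sq_mul_prod_one_sub_le_one a ha
  have hu2 := prod_one_add_one_sub_sq_sq_mul_prod_le_one a ha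
  set P1 := ∏ i, (1 + a i ^ 2) with hP1
  set P2 := ∏ i, (1 + (1 - a i) ^ 2) with hP2
  set A := ∏ i, a i with hAd
  set B := ∏ i, (1 - a i) with hBd
  obtain ⟨hf1, hf2, hf3⟩ := hf P1 P2 A B hA0 hA1 hB0 hB1 h1 h2 h4a h4b hR hRm hU hu1 hu2
  have hw : V a = ![1, P1, P2, A * B, A, B] := by
    ext i
    fin_cases i <;> simp [hc.1, hc.2.1, hc.2.2.1, hc.2.2.2.1, hc.2.2.2.2.1, hc.2.2.2.2.2]
  rw [hw]
  exact InCone_thetaTri_v1_of_le (w := ![1, P1, P2, A * B, A, B]) (p1 := (f P1 P2 A B).1) (p2 := (f P1 P2 A B).2)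
    (by simpa using hf1) (by simpa using hf2) (by simpa using hf3)

end RelaxedTriangle

end PercRepro
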